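import Mathlib
import Summits.ValiantsHypothesis.ValiantsHypothesis.Theorems.ElementaryWordLengthWordLengthQPStubKappaTwoStructureAux
import Summits.ValiantsHypothesis.ValiantsHypothesis.Theorems.ElementaryWordLengthWordLengthQPStubKappaTwoStructureAuxB
import Summits.ValiantsHypothesis.ValiantsHypothesis.Theorems.ElementaryWordLengthWordLengthQPStubKappaTwoStructureAuxC
import Summits.ValiantsHypothesis.ValiantsHypothesis.Theorems.ElementaryWordLengthWordLengthQPStubKappaTwoStructureAuxD
import Summits.ValiantsHypothesis.ValiantsHypothesis.Theorems.ElementaryWordLengthWordLengthQPStubKappaTwoStructureAuxE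
import Summits.ValiantsHypothesis.ValiantsHypothesis.Theorems.ElementaryWordLengthWordLengthQPStubKappaTwoStructureAuxF
import Summits.ValiantsHypothesis.ValiantsHypothesis.Theorems.ElementaryWordLengthWordLengthQPStubKappaTwoStructureAuxG
import Summits.ValiantsHypothesis.ValiantsHypothesis.Theorems.ElementaryWordLengthWordLengthQPStubKappaTwoStructureAuxH
import Summits.ValiantsHypothesis.ValiantsHypothesis.Theorems.ElementaryWordLengthWordLengthQPStubKappaTwoStructureAuxI

/-!
# Crux `WordLengthQP` (stmt-ValiantsHypothesis-6623), line `positive-monoid-exits` —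
helpers for stub `stub_kappaTwoStructure`, part J: the `(y₁, y₂)` and `(x₂, x₁)` families are
impossible.

* `k2_family_III` (`ℓ₁` of type `(1,0)`, `ℓ₂` of type `(2,1)`): skeletons are lower
  unitriangular after confinement, the kill lemma with the test `X ↦ X₁₂` annihilates every
  variable `x₂`-letter, so no letter feeds column `2` and `F = 0`.
* `k2_family_IV` (`ℓ₁` of type `(1,2)`, `ℓ₂` of type `(0,1)`): skeletons are upper unitriangular,
  the tests `X ↦ X₁₀` and `X ↦ X₂₁` annihilate every variable `y₁`- and `y₂`-letter, so the word
  is a product of upper unitriangular letters and `F = W₀₂` has total degree `≤ 2`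
  (`k2_close_upper`), contradicting `deg ≥ 3`.
-/

set_option linter.dupNamespace false

noncomputable section

namespace Summit.ValiantsHypothesis.ValiantsHypothesis.Cruxes.WordLengthQP.PositiveMonoidExits

open MvPolynomial

/-- **Closing lemma (upper).** A word all of whose letters with nonzero coefficient are of type
`x₁ = (0,1)` or `x₂ = (1,2)` computes `E₀₂(F)` only with `F` of total degree `≤ 2`. [folklore] -/
theorem k2_close_upper {σ : Type} (F : MvPolynomial σ ℝ) (w : List (Fin 3 × Fin 3 × ℝ × Option σ))
    (h : ∀ l ∈ w, l.2.2.1 ≠ 0 → (l.1 = 0 ∧ l.2.1 = 1) ∨ (l.1 = 1 ∧ l.2.1 = 2))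
    (hF : (w.map (fun l => (Matrix.transvection (Prod.fst l) (Prod.fst (Prod.snd l)) (MvPolynomial.C (Prod.fst (Prod.snd (Prod.snd l))) * Option.elim (Prod.snd (Prod.snd (Prod.snd l))) 1 MvPolynomial.X) : Matrix (Fin 3) (Fin 3) (MvPolynomial σ ℝ)))).prod = Matrix.transvection (0 : Fin 3) 2 F) :
    F.totalDegree ≤ 2 := by
  have key : ((w.map (fun l => (Matrix.transvection (Prod.fst l) (Prod.fst (Prod.snd l)) (MvPolynomial.C (Prod.fst (Prod.snd (Prod.snd l))) * Option.elim (Prod.snd (Prod.snd (Prod.snd l))) 1 MvPolynomial.X) : Matrix (Fin 3) (Fin 3) (MvPolynomial σ ℝ)))).prod 1 0 = 0 ∧ (w.map (fun l => (Matrix.transvection (Prod.fst l) (Prod.fst (Prod.snd l)) (MvPolynomial.C (Prod.fst (Prod.snd (Prod.snd l))) * Option.elim (Prod.snd (Prod.snd (Prod.snd l))) 1 MvPolynomial.X) : Matrix (Fin 3) (Fin 3) (MvPolynomial σ ℝ)))).prod 2 0 = 0 ∧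
      (w.map (fun l => (Matrix.transvection (Prod.fst l) (Prod.fst (Prod.snd l)) (MvPolynomial.C (Prod.fst (Prod.snd (Prod.snd l))) * Option.elim (Prod.snd (Prod.snd (Prod.snd l))) 1 MvPolynomial.X) : Matrix (Fin 3) (Fin 3) (MvPolynomial σ ℝ)))).prod 2 1 = 0 ∧ (w.map (fun l => (Matrix.transvection (Prod.fst l) (Prod.fst (Prod.snd l)) (MvPolynomial.C (Prod.fst (Prod.snd (Prod.snd l))) * Option.elim (Prod.snd (Prod.snd (Prod.snd l))) 1 MvPolynomial.X) : Matrix (Fin 3) (Fin 3) (MvPolynomial σ ℝ)))).prod 0 0 = 1 ∧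
      (w.map (fun l => (Matrix.transvection (Prod.fst l) (Prod.fst (Prod.snd l)) (MvPolynomial.C (Prod.fst (Prod.snd (Prod.snd l))) * Option.elim (Prod.snd (Prod.snd (Prod.snd l))) 1 MvPolynomial.X) : Matrix (Fin 3) (Fin 3) (MvPolynomial σ ℝ)))).prod 1 1 = 1 ∧ (w.map (fun l => (Matrix.transvection (Prod.fst l) (Prod.fst (Prod.snd l)) (MvPolynomial.C (Prod.fst (Prod.snd (Prod.snd l))) * Option.elim (Prod.snd (Prod.snd (Prod.snd l))) 1 MvPolynomial.X) : Matrix (Fin 3) (Fin 3) (MvPolynomial σ ℝ)))).prod 2 2 = 1) ∧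
      ((w.map (fun l => (Matrix.transvection (Prod.fst l) (Prod.fst (Prod.snd l)) (MvPolynomial.C (Prod.fst (Prod.snd (Prod.snd l))) * Option.elim (Prod.snd (Prod.snd (Prod.snd l))) 1 MvPolynomial.X) : Matrix (Fin 3) (Fin 3) (MvPolynomial σ ℝ)))).prod 0 1).totalDegree ≤ 1 ∧
      ((w.map (fun l => (Matrix.transvection (Prod.fst l) (Prod.fst (Prod.snd l)) (MvPolynomial.C (Prod.fst (Prod.snd (Prod.snd l))) * Option.elim (Prod.snd (Prod.snd (Prod.snd l))) 1 MvPolynomial.X) : Matrix (Fin 3) (Fin 3) (MvPolynomial σ ℝ)))).prod 1 2).totalDegree ≤ 1 ∧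
      ((w.map (fun l => (Matrix.transvection (Prod.fst l) (Prod.fst (Prod.snd l)) (MvPolynomial.C (Prod.fst (Prod.snd (Prod.snd l))) * Option.elim (Prod.snd (Prod.snd (Prod.snd l))) 1 MvPolynomial.X) : Matrix (Fin 3) (Fin 3) (MvPolynomial σ ℝ)))).prod 0 2).totalDegree ≤ 2 := by
    clear hF
    induction w with
    | nil => simp
    | cons l w ih =>
      obtain ⟨⟨h10, h20, h21, h00, h11, h22⟩, d01, d12, d02⟩ := ih (fun l' hl' => h l' (by simp [hl']))
      rw [List.map_cons, List.prod_cons]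
      set Q := (w.map (fun l => (Matrix.transvection (Prod.fst l) (Prod.fst (Prod.snd l)) (MvPolynomial.C (Prod.fst (Prod.snd (Prod.snd l))) * Option.elim (Prod.snd (Prod.snd (Prod.snd l))) 1 MvPolynomial.X) : Matrix (Fin 3) (Fin 3) (MvPolynomial σ ℝ)))).prod with hQ
      have hl : (Matrix.transvection (Prod.fst l) (Prod.fst (Prod.snd l)) (MvPolynomial.C (Prod.fst (Prod.snd (Prod.snd l))) * Option.elim (Prod.snd (Prod.snd (Prod.snd l))) 1 MvPolynomial.X) : Matrix (Fin 3) (Fin 3) (MvPolynomial σ ℝ)) = 1 ∨ (∃ a : MvPolynomial σ ℝ, a.totalDegree ≤ 1 ∧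
          ((Matrix.transvection (Prod.fst l) (Prod.fst (Prod.snd l)) (MvPolynomial.C (Prod.fst (Prod.snd (Prod.snd l))) * Option.elim (Prod.snd (Prod.snd (Prod.snd l))) 1 MvPolynomial.X) : Matrix (Fin 3) (Fin 3) (MvPolynomial σ ℝ)) = Matrix.transvection 0 1 a ∨ (Matrix.transvection (Prod.fst l) (Prod.fst (Prod.snd l)) (MvPolynomial.C (Prod.fst (Prod.snd (Prod.snd l))) * Option.elim (Prod.snd (Prod.snd (Prod.snd l))) 1 MvPolynomial.X) : Matrix (Fin 3) (Fin 3) (MvPolynomial σ ℝ)) = Matrix.transvection 1 2 a)) := by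
        by_cases hc : l.2.2.1 = 0
        · left; simp [hc]
        · rcases h l (by simp) hc with ⟨h1, h2⟩ | ⟨h1, h2⟩
          · exact Or.inr ⟨_, k2_totalDegree_Cu l.2.2.1 l.2.2.2, Or.inl (by rw [h1, h2])⟩
          · exact Or.inr ⟨_, k2_totalDegree_Cu l.2.2.1 l.2.2.2, Or.inr (by rw [h1, h2])⟩
      rcases hl with h1 | ⟨a, ha, h1 | h1⟩ <;> rw [h1]
      · simpa [hQ] using And.intro (And.intro h10 (And.intro h20 (And.intro h21 (And.intro h00
          (And.intro h11 h22))))) (And.intro d01 (And.intro d12 d02))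
      · have r0 : ∀ k, (Matrix.transvection (0 : Fin 3) 1 a * Q) 0 k = Q 0 k + a * Q 1 k := fun k =>
          Matrix.transvection_mul_apply_same _ _ _ _ _
        have r1 : ∀ k, (Matrix.transvection (0 : Fin 3) 1 a * Q) 1 k = Q 1 k := fun k =>
          Matrix.transvection_mul_apply_of_ne _ _ _ _ (by decide) _ _
        have r2 : ∀ k, (Matrix.transvection (0 : Fin 3) 1 a * Q) 2 k = Q 2 k := fun k =>
          Matrix.transvection_mul_apply_of_ne _ _ _ _ (by decide) _ _
        refine ⟨⟨by rw [r1, h10], by rw [r2, h20], by rw [r2, h21], by rw [r0, h00, h10]; ring,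
          by rw [r1, h11], by rw [r2, h22]⟩, ?_, by rw [r1]; exact d12, ?_⟩
        · rw [r0, h11, mul_one]
          exact (MvPolynomial.totalDegree_add _ _).trans (max_le d01 ha)
        · rw [r0]
          refine (MvPolynomial.totalDegree_add _ _).trans (max_le d02 ?_)
          refine (MvPolynomial.totalDegree_mul _ _).trans ?_
          omega
      · have r1 : ∀ k, (Matrix.transvection (1 : Fin 3) 2 a * Q) 1 k = Q 1 k + a * Q 2 k := fun k =>
          Matrix.transvection_mul_apply_same _ _ _ _ _
        have r0 : ∀ k, (Matrix.transvection (1 : Fin 3) 2 a * Q) 0 k = Q 0 k := fun k =>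
          Matrix.transvection_mul_apply_of_ne _ _ _ _ (by decide) _ _
        have r2 : ∀ k, (Matrix.transvection (1 : Fin 3) 2 a * Q) 2 k = Q 2 k := fun k =>
          Matrix.transvection_mul_apply_of_ne _ _ _ _ (by decide) _ _
        refine ⟨⟨by rw [r1, h10, h20]; ring, by rw [r2, h20], by rw [r2, h21], by rw [r0, h00],
          by rw [r1, h11, h21]; ring, by rw [r2, h22]⟩, by rw [r0]; exact d01, ?_, by rw [r0]; exact d02⟩
        rw [r1, h22, mul_one]
        exact (MvPolynomial.totalDegree_add _ _).trans (max_le d12 ha)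
  have := key.2.2.2
  rw [hF] at this
  simpa [Matrix.transvection] using this

/-- **Family `(y₁, y₂)` is impossible.** [folklore] -/
theorem k2_family_III {σ : Type} (F : MvPolynomial σ ℝ)
    (hdeg : ∀ m ∈ F.support, 3 ≤ Finsupp.degree m) (hF0 : F ≠ 0)
    (p0 q p2 : List (Fin 3 × Fin 3 × ℝ × Option σ)) (L1 L2 : Fin 3 × Fin 3 × ℝ × Option σ)
    (hw : ∀ l ∈ p0 ++ L1 :: (q ++ L2 :: p2), l.1 ≠ l.2.1)
    (ht : ∀ l ∈ p0 ++ q ++ p2, ((0 < Prod.fst (Prod.snd (Prod.snd l)) ∧ (Fin.val (Prod.fst l) + 1 = Fin.val (Prod.fst (Prod.snd l)) ∨ Fin.val (Prod.fst (Prod.snd l)) + 1 = Fin.val (Prod.fst l))) ∨ Prod.fst (Prod.snd (Prod.snd l)) = 0))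
    (hL1 : L1.1 = 1 ∧ L1.2.1 = 0) (hL2 : L2.1 = 2 ∧ L2.2.1 = 1)
    (hF : ((p0 ++ L1 :: (q ++ L2 :: p2)).map (fun l => (Matrix.transvection (Prod.fst l) (Prod.fst (Prod.snd l)) (MvPolynomial.C (Prod.fst (Prod.snd (Prod.snd l))) * Option.elim (Prod.snd (Prod.snd (Prod.snd l))) 1 MvPolynomial.X) : Matrix (Fin 3) (Fin 3) (MvPolynomial σ ℝ)))).prod =
      Matrix.transvection (0 : Fin 3) 2 F) : False := by
  classical
  set w := p0 ++ L1 :: (q ++ L2 :: p2) with hwdef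
  have hdeg1 : ∀ m ∈ F.support, 1 ≤ Finsupp.degree m := fun m hm => le_trans (by norm_num) (hdeg m hm)
  have hdeg2 : ∀ m ∈ F.support, 2 ≤ Finsupp.degree m := fun m hm => le_trans (by norm_num) (hdeg m hm)
  set a : ℝ := L1.2.2.2.elim L1.2.2.1 (fun _ => 0) with ha
  set b : ℝ := L2.2.2.2.elim L2.2.2.1 (fun _ => 0) with hb
  have hcL1 : (Matrix.transvection (Prod.fst L1) (Prod.fst (Prod.snd L1)) (Option.elim (Prod.snd (Prod.snd (Prod.snd L1))) (Prod.fst (Prod.snd (Prod.snd L1))) (fun _ => (0 : ℝ))) : Matrix (Fin 3) (Fin 3) ℝ) = Matrix.transvection 1 0 a := by rw [hL1.1, hL1.2]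
  have hcL2 : (Matrix.transvection (Prod.fst L2) (Prod.fst (Prod.snd L2)) (Option.elim (Prod.snd (Prod.snd (Prod.snd L2))) (Prod.fst (Prod.snd (Prod.snd L2))) (fun _ => (0 : ℝ))) : Matrix (Fin 3) (Fin 3) ℝ) = Matrix.transvection 2 1 b := by rw [hL2.1, hL2.2]
  have hsk := k2_skel_loop F hdeg1 w hF
  have hloop : (p0.map (fun l => (Matrix.transvection (Prod.fst l) (Prod.fst (Prod.snd l)) (Option.elim (Prod.snd (Prod.snd (Prod.snd l))) (Prod.fst (Prod.snd (Prod.snd l))) (fun _ => (0 : ℝ))) : Matrix (Fin 3) (Fin 3) ℝ))).prod * (Matrix.transvection 1 0 a *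
      ((q.map (fun l => (Matrix.transvection (Prod.fst l) (Prod.fst (Prod.snd l)) (Option.elim (Prod.snd (Prod.snd (Prod.snd l))) (Prod.fst (Prod.snd (Prod.snd l))) (fun _ => (0 : ℝ))) : Matrix (Fin 3) (Fin 3) ℝ))).prod * (Matrix.transvection 2 1 b * (p2.map (fun l => (Matrix.transvection (Prod.fst l) (Prod.fst (Prod.snd l)) (Option.elim (Prod.snd (Prod.snd (Prod.snd l))) (Prod.fst (Prod.snd (Prod.snd l))) (fun _ => (0 : ℝ))) : Matrix (Fin 3) (Fin 3) ℝ))).prod))) = 1 := by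
    simpa only [hwdef, List.map_append, List.map_cons, List.prod_append, List.prod_cons, hcL1, hcL2]
      using hsk
  have conf := k2_conf_III p0 q p2 a b ht hloop
  have low : ∀ l ∈ w, (Matrix.transvection (Prod.fst l) (Prod.fst (Prod.snd l)) (Option.elim (Prod.snd (Prod.snd (Prod.snd l))) (Prod.fst (Prod.snd (Prod.snd l))) (fun _ => (0 : ℝ))) : Matrix (Fin 3) (Fin 3) ℝ) 0 1 = 0 ∧ (Matrix.transvection (Prod.fst l) (Prod.fst (Prod.snd l)) (Option.elim (Prod.snd (Prod.snd (Prod.snd l))) (Prod.fst (Prod.snd (Prod.snd l))) (fun _ => (0 : ℝ))) : Matrix (Fin 3) (Fin 3) ℝ) 0 2 = 0 ∧ (Matrix.transvection (Prod.fst l) (Prod.fst (Prod.snd l)) (Option.elim (Prod.snd (Prod.snd (Prod.snd l))) (Prod.fst (Prod.snd (Prod.snd l))) (fun _ => (0 : ℝ))) : Matrix (Fin 3) (Fin 3) ℝ) 1 2 = 0 ∧ (Matrix.transvection (Prod.fst l) (Prod.fst (Prod.snd l)) (Option.elim (Prod.snd (Prod.snd (Prod.snd l))) (Prod.fst (Prod.snd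 (Prod.snd l))) (fun _ => (0 : ℝ))) : Matrix (Fin 3) (Fin 3) ℝ) 0 0 = 1 ∧
      (Matrix.transvection (Prod.fst l) (Prod.fst (Prod.snd l)) (Option.elim (Prod.snd (Prod.snd (Prod.snd l))) (Prod.fst (Prod.snd (Prod.snd l))) (fun _ => (0 : ℝ))) : Matrix (Fin 3) (Fin 3) ℝ) 1 1 = 1 ∧ (Matrix.transvection (Prod.fst l) (Prod.fst (Prod.snd l)) (Option.elim (Prod.snd (Prod.snd (Prod.snd l))) (Prod.fst (Prod.snd (Prod.snd l))) (fun _ => (0 : ℝ))) : Matrix (Fin 3) (Fin 3) ℝ) 2 2 = 1 := by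
    intro l hl
    rcases k2_mem_word p0 q p2 L1 L2 l hl with rfl | rfl | hl'
    · rw [hcL1]; exact k2_lowu_letter 1 0 (by decide) a
    · rw [hcL2]; exact k2_lowu_letter 2 1 (by decide) b
    · exact k2_lowu_skel l (ht l hl') (fun ho => (conf l hl' ho).1) (fun ho => (conf l hl' ho).2)
  have shape : ∀ (A : List _) (l : Fin 3 × Fin 3 × ℝ × Option σ) (B : List _), w = A ++ l :: B →
      ((A.map (fun l => (Matrix.transvection (Prod.fst l) (Prod.fst (Prod.snd l)) (Option.elim (Prod.snd (Prod.snd (Prod.snd l))) (Prod.fst (Prod.snd (Prod.snd l))) (fun _ => (0 : ℝ))) : Matrix (Fin 3) (Fin 3) ℝ))).prod 0 1 = 0 ∧ (A.map (fun l => (Matrix.transvection (Prod.fst l) (Prod.fst (Prod.snd l)) (Option.elim (Prod.snd (Prod.snd (Prod.snd l))) (Prod.fst (Prod.snd (Prod.snd l))) (fun _ => (0 : ℝ))) : Matrix (Fin 3) (Fin 3) ℝ))).prod 0 2 = 0 ∧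
        (A.map (fun l => (Matrix.transvection (Prod.fst l) (Prod.fst (Prod.snd l)) (Option.elim (Prod.snd (Prod.snd (Prod.snd l))) (Prod.fst (Prod.snd (Prod.snd l))) (fun _ => (0 : ℝ))) : Matrix (Fin 3) (Fin 3) ℝ))).prod 1 2 = 0 ∧ (A.map (fun l => (Matrix.transvection (Prod.fst l) (Prod.fst (Prod.snd l)) (Option.elim (Prod.snd (Prod.snd (Prod.snd l))) (Prod.fst (Prod.snd (Prod.snd l))) (fun _ => (0 : ℝ))) : Matrix (Fin 3) (Fin 3) ℝ))).prod 0 0 = 1 ∧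
        (A.map (fun l => (Matrix.transvection (Prod.fst l) (Prod.fst (Prod.snd l)) (Option.elim (Prod.snd (Prod.snd (Prod.snd l))) (Prod.fst (Prod.snd (Prod.snd l))) (fun _ => (0 : ℝ))) : Matrix (Fin 3) (Fin 3) ℝ))).prod 1 1 = 1 ∧ (A.map (fun l => (Matrix.transvection (Prod.fst l) (Prod.fst (Prod.snd l)) (Option.elim (Prod.snd (Prod.snd (Prod.snd l))) (Prod.fst (Prod.snd (Prod.snd l))) (fun _ => (0 : ℝ))) : Matrix (Fin 3) (Fin 3) ℝ))).prod 2 2 = 1) ∧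
      ((B.map (fun l => (Matrix.transvection (Prod.fst l) (Prod.fst (Prod.snd l)) (Option.elim (Prod.snd (Prod.snd (Prod.snd l))) (Prod.fst (Prod.snd (Prod.snd l))) (fun _ => (0 : ℝ))) : Matrix (Fin 3) (Fin 3) ℝ))).prod 0 1 = 0 ∧ (B.map (fun l => (Matrix.transvection (Prod.fst l) (Prod.fst (Prod.snd l)) (Option.elim (Prod.snd (Prod.snd (Prod.snd l))) (Prod.fst (Prod.snd (Prod.snd l))) (fun _ => (0 : ℝ))) : Matrix (Fin 3) (Fin 3) ℝ))).prod 0 2 = 0 ∧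
        (B.map (fun l => (Matrix.transvection (Prod.fst l) (Prod.fst (Prod.snd l)) (Option.elim (Prod.snd (Prod.snd (Prod.snd l))) (Prod.fst (Prod.snd (Prod.snd l))) (fun _ => (0 : ℝ))) : Matrix (Fin 3) (Fin 3) ℝ))).prod 1 2 = 0 ∧ (B.map (fun l => (Matrix.transvection (Prod.fst l) (Prod.fst (Prod.snd l)) (Option.elim (Prod.snd (Prod.snd (Prod.snd l))) (Prod.fst (Prod.snd (Prod.snd l))) (fun _ => (0 : ℝ))) : Matrix (Fin 3) (Fin 3) ℝ))).prod 0 0 = 1 ∧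
        (B.map (fun l => (Matrix.transvection (Prod.fst l) (Prod.fst (Prod.snd l)) (Option.elim (Prod.snd (Prod.snd (Prod.snd l))) (Prod.fst (Prod.snd (Prod.snd l))) (fun _ => (0 : ℝ))) : Matrix (Fin 3) (Fin 3) ℝ))).prod 1 1 = 1 ∧ (B.map (fun l => (Matrix.transvection (Prod.fst l) (Prod.fst (Prod.snd l)) (Option.elim (Prod.snd (Prod.snd (Prod.snd l))) (Prod.fst (Prod.snd (Prod.snd l))) (fun _ => (0 : ℝ))) : Matrix (Fin 3) (Fin 3) ℝ))).prod 2 2 = 1) := by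
    intro A l B hAB
    constructor <;> refine k2_lowu_prod _ fun G hG => ?_ <;> obtain ⟨l', hl', rfl⟩ := List.mem_map.1 hG
    · exact low l' (by rw [hAB]; simp [hl'])
    · exact low l' (by rw [hAB]; simp [hl'])
  have three : ∀ i : Fin 3, i = 0 ∨ i = 1 ∨ i = 2 := by decide
  have col2mem : ∀ l ∈ w, l.2.1 = 2 → ((0 < Prod.fst (Prod.snd (Prod.snd l)) ∧ (Fin.val (Prod.fst l) + 1 = Fin.val (Prod.fst (Prod.snd l)) ∨ Fin.val (Prod.fst (Prod.snd l)) + 1 = Fin.val (Prod.fst l))) ∨ Prod.fst (Prod.snd (Prod.snd l)) = 0) ∧ l ∈ p0 ++ q ++ p2 := by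
    intro l hl hj
    rcases k2_mem_word p0 q p2 L1 L2 l hl with rfl | rfl | hl'
    · exact absurd (hL1.2.symm.trans hj) (by decide)
    · exact absurd (hL2.2.symm.trans hj) (by decide)
    · exact ⟨ht l hl', hl'⟩
  have far0 : ∀ l ∈ w, l.2.1 = 2 → l.1 = 0 → l.2.2.1 = 0 := by
    intro l hl hj hi
    rcases (col2mem l hl hj).1 with ⟨-, hadj⟩ | h0
    · rw [hi, hj] at hadj; simp at hadj
    · exact h0
  have killed : ∀ l ∈ w, l.1 = 1 → l.2.1 = 2 → ∀ v, l.2.2.2 = some v → l.2.2.1 = 0 := by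
    intro l hl hi hj v hv
    obtain ⟨A, B, hAB⟩ := List.append_of_mem hl
    have hnn : ∀ (A : List _) (l : Fin 3 × Fin 3 × ℝ × Option σ) (B : List _), w = A ++ l :: B →
        l.2.2.2 = some v →
        0 ≤ (1 * (A.map (fun l => (Matrix.transvection (Prod.fst l) (Prod.fst (Prod.snd l)) (Option.elim (Prod.snd (Prod.snd (Prod.snd l))) (Prod.fst (Prod.snd (Prod.snd l))) (fun _ => (0 : ℝ))) : Matrix (Fin 3) (Fin 3) ℝ))).prod : Matrix (Fin 3) (Fin 3) ℝ) 1 l.1 * l.2.2.1 *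
          ((B.map (fun l => (Matrix.transvection (Prod.fst l) (Prod.fst (Prod.snd l)) (Option.elim (Prod.snd (Prod.snd (Prod.snd l))) (Prod.fst (Prod.snd (Prod.snd l))) (fun _ => (0 : ℝ))) : Matrix (Fin 3) (Fin 3) ℝ))).prod * 1 : Matrix (Fin 3) (Fin 3) ℝ) l.2.1 2 := by
      intro A l B hAB _
      rw [Matrix.mul_one, Matrix.one_mul]
      obtain ⟨hA, hB⟩ := shape A l B hAB
      have hlw : l ∈ w := by rw [hAB]; simp
      rcases three l.2.1 with hj | hj | hj
      · rw [hj, hB.2.1, mul_zero]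
      · rw [hj, hB.2.2.1, mul_zero]
      · rw [hj, hB.2.2.2.2.2, mul_one]
        rcases three l.1 with hi | hi | hi
        · rw [far0 l hlw hj hi]; simp
        · rw [hi, hA.2.2.2.2.1, one_mul]
          rcases (col2mem l hlw hj).1 with ⟨hc, -⟩ | h0
          · exact hc.le
          · exact h0.ge
        · exact absurd (hi.trans hj.symm) (hw l hlw)
    have K := k2_kill v w 1 1 1 2 hnn
    have hsum : (1 * (Matrix.map ((w.map (fun l => (Matrix.transvection (Prod.fst l) (Prod.fst (Prod.snd l)) (MvPolynomial.C (Prod.fst (Prod.snd (Prod.snd l))) * Option.elim (Prod.snd (Prod.snd (Prod.snd l))) 1 MvPolynomial.X) : Matrix (Fin 3) (Fin 3) (MvPolynomial σ ℝ)))).prod) (fun p => MvPolynomial.constantCoeff (MvPolynomial.pderiv v p)) : Matrix (Fin 3) (Fin 3) ℝ) * 1 : Matrix (Fin 3) (Fin 3) ℝ) 1 2 = 0 := by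
      rw [hF, k2Dm_far v F hdeg2]; simp
    have := K.2 hsum A l B hAB hv
    obtain ⟨hA, hB⟩ := shape A l B hAB
    rw [hi, hj, Matrix.mul_one, Matrix.one_mul, hA.2.2.2.2.1, hB.2.2.2.2.2, one_mul, mul_one] at this
    exact this
  refine hF0 (k2_close_col2 F w (fun l hl hj => ?_) hF)
  obtain ⟨htl, hl'⟩ := col2mem l hl hj
  rcases three l.1 with hi | hi | hi
  · exact far0 l hl hj hi
  · rcases ho : l.2.2.2 with _ | v
    · exact (conf l hl' ho).2 hi hj
    · exact killed l hl hi hj v ho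
  · exact absurd (hi.trans hj.symm) (hw l hl)

/-- **Family `(x₂, x₁)` is impossible.** [folklore] -/
theorem k2_family_IV {σ : Type} (F : MvPolynomial σ ℝ)
    (hdeg : ∀ m ∈ F.support, 3 ≤ Finsupp.degree m) (hF0 : F ≠ 0)
    (p0 q p2 : List (Fin 3 × Fin 3 × ℝ × Option σ)) (L1 L2 : Fin 3 × Fin 3 × ℝ × Option σ)
    (hw : ∀ l ∈ p0 ++ L1 :: (q ++ L2 :: p2), l.1 ≠ l.2.1)
    (ht : ∀ l ∈ p0 ++ q ++ p2, ((0 < Prod.fst (Prod.snd (Prod.snd l)) ∧ (Fin.val (Prod.fst l) + 1 = Fin.val (Prod.fst (Prod.snd l)) ∨ Fin.val (Prod.fst (Prod.snd l)) + 1 = Fin.val (Prod.fst l))) ∨ Prod.fst (Prod.snd (Prod.snd l)) = 0))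
    (hL1 : L1.1 = 1 ∧ L1.2.1 = 2) (hL2 : L2.1 = 0 ∧ L2.2.1 = 1)
    (hF : ((p0 ++ L1 :: (q ++ L2 :: p2)).map (fun l => (Matrix.transvection (Prod.fst l) (Prod.fst (Prod.snd l)) (MvPolynomial.C (Prod.fst (Prod.snd (Prod.snd l))) * Option.elim (Prod.snd (Prod.snd (Prod.snd l))) 1 MvPolynomial.X) : Matrix (Fin 3) (Fin 3) (MvPolynomial σ ℝ)))).prod =
      Matrix.transvection (0 : Fin 3) 2 F) : False := by
  classical
  set w := p0 ++ L1 :: (q ++ L2 :: p2) with hwdef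
  have hdeg1 : ∀ m ∈ F.support, 1 ≤ Finsupp.degree m := fun m hm => le_trans (by norm_num) (hdeg m hm)
  have hdeg2 : ∀ m ∈ F.support, 2 ≤ Finsupp.degree m := fun m hm => le_trans (by norm_num) (hdeg m hm)
  set a : ℝ := L1.2.2.2.elim L1.2.2.1 (fun _ => 0) with ha
  set b : ℝ := L2.2.2.2.elim L2.2.2.1 (fun _ => 0) with hb
  have hcL1 : (Matrix.transvection (Prod.fst L1) (Prod.fst (Prod.snd L1)) (Option.elim (Prod.snd (Prod.snd (Prod.snd L1))) (Prod.fst (Prod.snd (Prod.snd L1))) (fun _ => (0 : ℝ))) : Matrix (Fin 3) (Fin 3) ℝ) = Matrix.transvection 1 2 a := by rw [hL1.1, hL1.2]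
  have hcL2 : (Matrix.transvection (Prod.fst L2) (Prod.fst (Prod.snd L2)) (Option.elim (Prod.snd (Prod.snd (Prod.snd L2))) (Prod.fst (Prod.snd (Prod.snd L2))) (fun _ => (0 : ℝ))) : Matrix (Fin 3) (Fin 3) ℝ) = Matrix.transvection 0 1 b := by rw [hL2.1, hL2.2]
  have hsk := k2_skel_loop F hdeg1 w hF
  have hloop : (p0.map (fun l => (Matrix.transvection (Prod.fst l) (Prod.fst (Prod.snd l)) (Option.elim (Prod.snd (Prod.snd (Prod.snd l))) (Prod.fst (Prod.snd (Prod.snd l))) (fun _ => (0 : ℝ))) : Matrix (Fin 3) (Fin 3) ℝ))).prod * (Matrix.transvection 1 2 a *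
      ((q.map (fun l => (Matrix.transvection (Prod.fst l) (Prod.fst (Prod.snd l)) (Option.elim (Prod.snd (Prod.snd (Prod.snd l))) (Prod.fst (Prod.snd (Prod.snd l))) (fun _ => (0 : ℝ))) : Matrix (Fin 3) (Fin 3) ℝ))).prod * (Matrix.transvection 0 1 b * (p2.map (fun l => (Matrix.transvection (Prod.fst l) (Prod.fst (Prod.snd l)) (Option.elim (Prod.snd (Prod.snd (Prod.snd l))) (Prod.fst (Prod.snd (Prod.snd l))) (fun _ => (0 : ℝ))) : Matrix (Fin 3) (Fin 3) ℝ))).prod))) = 1 := by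
    simpa only [hwdef, List.map_append, List.map_cons, List.prod_append, List.prod_cons, hcL1, hcL2]
      using hsk
  have conf := k2_conf_IV p0 q p2 a b ht hloop
  have up : ∀ l ∈ w, (Matrix.transvection (Prod.fst l) (Prod.fst (Prod.snd l)) (Option.elim (Prod.snd (Prod.snd (Prod.snd l))) (Prod.fst (Prod.snd (Prod.snd l))) (fun _ => (0 : ℝ))) : Matrix (Fin 3) (Fin 3) ℝ) 1 0 = 0 ∧ (Matrix.transvection (Prod.fst l) (Prod.fst (Prod.snd l)) (Option.elim (Prod.snd (Prod.snd (Prod.snd l))) (Prod.fst (Prod.snd (Prod.snd l))) (fun _ => (0 : ℝ))) : Matrix (Fin 3) (Fin 3) ℝ) 2 0 = 0 ∧ (Matrix.transvection (Prod.fst l) (Prod.fst (Prod.snd l)) (Option.elim (Prod.snd (Prod.snd (Prod.snd l))) (Prod.fst (Prod.snd (Prod.snd l))) (fun _ => (0 : ℝ))) : Matrix (Fin 3) (Fin 3) ℝ) 2 1 = 0 ∧ (Matrix.transvection (Prod.fst l) (Prod.fst (Prod.snd l)) (Option.elim (Prod.snd (Prod.snd (Prod.snd l))) (Prod.fst (Prod.snd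 (Prod.snd l))) (fun _ => (0 : ℝ))) : Matrix (Fin 3) (Fin 3) ℝ) 0 0 = 1 ∧
      (Matrix.transvection (Prod.fst l) (Prod.fst (Prod.snd l)) (Option.elim (Prod.snd (Prod.snd (Prod.snd l))) (Prod.fst (Prod.snd (Prod.snd l))) (fun _ => (0 : ℝ))) : Matrix (Fin 3) (Fin 3) ℝ) 1 1 = 1 ∧ (Matrix.transvection (Prod.fst l) (Prod.fst (Prod.snd l)) (Option.elim (Prod.snd (Prod.snd (Prod.snd l))) (Prod.fst (Prod.snd (Prod.snd l))) (fun _ => (0 : ℝ))) : Matrix (Fin 3) (Fin 3) ℝ) 2 2 = 1 := by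
    intro l hl
    rcases k2_mem_word p0 q p2 L1 L2 l hl with rfl | rfl | hl'
    · rw [hcL1]; exact k2_upu_letter 1 2 (by decide) a
    · rw [hcL2]; exact k2_upu_letter 0 1 (by decide) b
    · exact k2_upu_skel l (ht l hl') (fun ho => (conf l hl' ho).1) (fun ho => (conf l hl' ho).2)
  have shape : ∀ (A : List _) (l : Fin 3 × Fin 3 × ℝ × Option σ) (B : List _), w = A ++ l :: B →
      ((A.map (fun l => (Matrix.transvection (Prod.fst l) (Prod.fst (Prod.snd l)) (Option.elim (Prod.snd (Prod.snd (Prod.snd l))) (Prod.fst (Prod.snd (Prod.snd l))) (fun _ => (0 : ℝ))) : Matrix (Fin 3) (Fin 3) ℝ))).prod 1 0 = 0 ∧ (A.map (fun l => (Matrix.transvection (Prod.fst l) (Prod.fst (Prod.snd l)) (Option.elim (Prod.snd (Prod.snd (Prod.snd l))) (Prod.fst (Prod.snd (Prod.snd l))) (fun _ => (0 : ℝ))) : Matrix (Fin 3) (Fin 3) ℝ))).prod 2 0 = 0 ∧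
        (A.map (fun l => (Matrix.transvection (Prod.fst l) (Prod.fst (Prod.snd l)) (Option.elim (Prod.snd (Prod.snd (Prod.snd l))) (Prod.fst (Prod.snd (Prod.snd l))) (fun _ => (0 : ℝ))) : Matrix (Fin 3) (Fin 3) ℝ))).prod 2 1 = 0 ∧ (A.map (fun l => (Matrix.transvection (Prod.fst l) (Prod.fst (Prod.snd l)) (Option.elim (Prod.snd (Prod.snd (Prod.snd l))) (Prod.fst (Prod.snd (Prod.snd l))) (fun _ => (0 : ℝ))) : Matrix (Fin 3) (Fin 3) ℝ))).prod 0 0 = 1 ∧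
        (A.map (fun l => (Matrix.transvection (Prod.fst l) (Prod.fst (Prod.snd l)) (Option.elim (Prod.snd (Prod.snd (Prod.snd l))) (Prod.fst (Prod.snd (Prod.snd l))) (fun _ => (0 : ℝ))) : Matrix (Fin 3) (Fin 3) ℝ))).prod 1 1 = 1 ∧ (A.map (fun l => (Matrix.transvection (Prod.fst l) (Prod.fst (Prod.snd l)) (Option.elim (Prod.snd (Prod.snd (Prod.snd l))) (Prod.fst (Prod.snd (Prod.snd l))) (fun _ => (0 : ℝ))) : Matrix (Fin 3) (Fin 3) ℝ))).prod 2 2 = 1) ∧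
      ((B.map (fun l => (Matrix.transvection (Prod.fst l) (Prod.fst (Prod.snd l)) (Option.elim (Prod.snd (Prod.snd (Prod.snd l))) (Prod.fst (Prod.snd (Prod.snd l))) (fun _ => (0 : ℝ))) : Matrix (Fin 3) (Fin 3) ℝ))).prod 1 0 = 0 ∧ (B.map (fun l => (Matrix.transvection (Prod.fst l) (Prod.fst (Prod.snd l)) (Option.elim (Prod.snd (Prod.snd (Prod.snd l))) (Prod.fst (Prod.snd (Prod.snd l))) (fun _ => (0 : ℝ))) : Matrix (Fin 3) (Fin 3) ℝ))).prod 2 0 = 0 ∧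
        (B.map (fun l => (Matrix.transvection (Prod.fst l) (Prod.fst (Prod.snd l)) (Option.elim (Prod.snd (Prod.snd (Prod.snd l))) (Prod.fst (Prod.snd (Prod.snd l))) (fun _ => (0 : ℝ))) : Matrix (Fin 3) (Fin 3) ℝ))).prod 2 1 = 0 ∧ (B.map (fun l => (Matrix.transvection (Prod.fst l) (Prod.fst (Prod.snd l)) (Option.elim (Prod.snd (Prod.snd (Prod.snd l))) (Prod.fst (Prod.snd (Prod.snd l))) (fun _ => (0 : ℝ))) : Matrix (Fin 3) (Fin 3) ℝ))).prod 0 0 = 1 ∧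
        (B.map (fun l => (Matrix.transvection (Prod.fst l) (Prod.fst (Prod.snd l)) (Option.elim (Prod.snd (Prod.snd (Prod.snd l))) (Prod.fst (Prod.snd (Prod.snd l))) (fun _ => (0 : ℝ))) : Matrix (Fin 3) (Fin 3) ℝ))).prod 1 1 = 1 ∧ (B.map (fun l => (Matrix.transvection (Prod.fst l) (Prod.fst (Prod.snd l)) (Option.elim (Prod.snd (Prod.snd (Prod.snd l))) (Prod.fst (Prod.snd (Prod.snd l))) (fun _ => (0 : ℝ))) : Matrix (Fin 3) (Fin 3) ℝ))).prod 2 2 = 1) := by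
    intro A l B hAB
    constructor <;> refine k2_upu_prod _ fun G hG => ?_ <;> obtain ⟨l', hl', rfl⟩ := List.mem_map.1 hG
    · exact up l' (by rw [hAB]; simp [hl'])
    · exact up l' (by rw [hAB]; simp [hl'])
  have three : ∀ i : Fin 3, i = 0 ∨ i = 1 ∨ i = 2 := by decide
  have col0mem : ∀ l ∈ w, l.2.1 = 0 → ((0 < Prod.fst (Prod.snd (Prod.snd l)) ∧ (Fin.val (Prod.fst l) + 1 = Fin.val (Prod.fst (Prod.snd l)) ∨ Fin.val (Prod.fst (Prod.snd l)) + 1 = Fin.val (Prod.fst l))) ∨ Prod.fst (Prod.snd (Prod.snd l)) = 0) ∧ l ∈ p0 ++ q ++ p2 := by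
    intro l hl hj
    rcases k2_mem_word p0 q p2 L1 L2 l hl with rfl | rfl | hl'
    · exact absurd (hL1.2.symm.trans hj) (by decide)
    · exact absurd (hL2.2.symm.trans hj) (by decide)
    · exact ⟨ht l hl', hl'⟩
  have row2mem : ∀ l ∈ w, l.1 = 2 → ((0 < Prod.fst (Prod.snd (Prod.snd l)) ∧ (Fin.val (Prod.fst l) + 1 = Fin.val (Prod.fst (Prod.snd l)) ∨ Fin.val (Prod.fst (Prod.snd l)) + 1 = Fin.val (Prod.fst l))) ∨ Prod.fst (Prod.snd (Prod.snd l)) = 0) ∧ l ∈ p0 ++ q ++ p2 := by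
    intro l hl hi
    rcases k2_mem_word p0 q p2 L1 L2 l hl with rfl | rfl | hl'
    · exact absurd (hL1.1.symm.trans hi) (by decide)
    · exact absurd (hL2.1.symm.trans hi) (by decide)
    · exact ⟨ht l hl', hl'⟩
  have far20 : ∀ l ∈ w, l.1 = 2 → l.2.1 = 0 → l.2.2.1 = 0 := by
    intro l hl hi hj
    rcases (row2mem l hl hi).1 with ⟨-, hadj⟩ | h0
    · rw [hi, hj] at hadj; simp at hadj
    · exact h0
  have hc_of_tame : ∀ l : Fin 3 × Fin 3 × ℝ × Option σ, ((0 < Prod.fst (Prod.snd (Prod.snd l)) ∧ (Fin.val (Prod.fst l) + 1 = Fin.val (Prod.fst (Prod.snd l)) ∨ Fin.val (Prod.fst (Prod.snd l)) + 1 = Fin.val (Prod.fst l))) ∨ Prod.fst (Prod.snd (Prod.snd l)) = 0) → 0 ≤ l.2.2.1 := by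
    intro l hl
    rcases hl with ⟨hc, -⟩ | h0
    · exact hc.le
    · exact h0.ge
  have killed1 : ∀ l ∈ w, l.1 = 1 → l.2.1 = 0 → ∀ v, l.2.2.2 = some v → l.2.2.1 = 0 := by
    intro l hl hi hj v hv
    obtain ⟨A, B, hAB⟩ := List.append_of_mem hl
    have hnn : ∀ (A : List _) (l : Fin 3 × Fin 3 × ℝ × Option σ) (B : List _), w = A ++ l :: B →
        l.2.2.2 = some v →
        0 ≤ (1 * (A.map (fun l => (Matrix.transvection (Prod.fst l) (Prod.fst (Prod.snd l)) (Option.elim (Prod.snd (Prod.snd (Prod.snd l))) (Prod.fst (Prod.snd (Prod.snd l))) (fun _ => (0 : ℝ))) : Matrix (Fin 3) (Fin 3) ℝ))).prod : Matrix (Fin 3) (Fin 3) ℝ) 1 l.1 * l.2.2.1 *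
          ((B.map (fun l => (Matrix.transvection (Prod.fst l) (Prod.fst (Prod.snd l)) (Option.elim (Prod.snd (Prod.snd (Prod.snd l))) (Prod.fst (Prod.snd (Prod.snd l))) (fun _ => (0 : ℝ))) : Matrix (Fin 3) (Fin 3) ℝ))).prod * 1 : Matrix (Fin 3) (Fin 3) ℝ) l.2.1 0 := by
      intro A l B hAB _
      rw [Matrix.mul_one, Matrix.one_mul]
      obtain ⟨hA, hB⟩ := shape A l B hAB
      have hlw : l ∈ w := by rw [hAB]; simp
      rcases three l.2.1 with hj | hj | hj
      · rw [hj, hB.2.2.2.1, mul_one]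
        rcases three l.1 with hi | hi | hi
        · exact absurd (hi.trans hj.symm) (hw l hlw)
        · rw [hi, hA.2.2.2.2.1, one_mul]; exact hc_of_tame l (col0mem l hlw hj).1
        · rw [far20 l hlw hi hj]; simp
      · rw [hj, hB.1, mul_zero]
      · rw [hj, hB.2.1, mul_zero]
    have K := k2_kill v w 1 1 1 0 hnn
    have hsum : (1 * (Matrix.map ((w.map (fun l => (Matrix.transvection (Prod.fst l) (Prod.fst (Prod.snd l)) (MvPolynomial.C (Prod.fst (Prod.snd (Prod.snd l))) * Option.elim (Prod.snd (Prod.snd (Prod.snd l))) 1 MvPolynomial.X) : Matrix (Fin 3) (Fin 3) (MvPolynomial σ ℝ)))).prod) (fun p => MvPolynomial.constantCoeff (MvPolynomial.pderiv v p)) : Matrix (Fin 3) (Fin 3) ℝ) * 1 : Matrix (Fin 3) (Fin 3) ℝ) 1 0 = 0 := by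
      rw [hF, k2Dm_far v F hdeg2]; simp
    have := K.2 hsum A l B hAB hv
    obtain ⟨hA, hB⟩ := shape A l B hAB
    rw [hi, hj, Matrix.mul_one, Matrix.one_mul, hA.2.2.2.2.1, hB.2.2.2.1, one_mul, mul_one] at this
    exact this
  have killed2 : ∀ l ∈ w, l.1 = 2 → l.2.1 = 1 → ∀ v, l.2.2.2 = some v → l.2.2.1 = 0 := by
    intro l hl hi hj v hv
    obtain ⟨A, B, hAB⟩ := List.append_of_mem hl
    have hnn : ∀ (A : List _) (l : Fin 3 × Fin 3 × ℝ × Option σ) (B : List _), w = A ++ l :: B →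
        l.2.2.2 = some v →
        0 ≤ (1 * (A.map (fun l => (Matrix.transvection (Prod.fst l) (Prod.fst (Prod.snd l)) (Option.elim (Prod.snd (Prod.snd (Prod.snd l))) (Prod.fst (Prod.snd (Prod.snd l))) (fun _ => (0 : ℝ))) : Matrix (Fin 3) (Fin 3) ℝ))).prod : Matrix (Fin 3) (Fin 3) ℝ) 2 l.1 * l.2.2.1 *
          ((B.map (fun l => (Matrix.transvection (Prod.fst l) (Prod.fst (Prod.snd l)) (Option.elim (Prod.snd (Prod.snd (Prod.snd l))) (Prod.fst (Prod.snd (Prod.snd l))) (fun _ => (0 : ℝ))) : Matrix (Fin 3) (Fin 3) ℝ))).prod * 1 : Matrix (Fin 3) (Fin 3) ℝ) l.2.1 1 := by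
      intro A l B hAB _
      rw [Matrix.mul_one, Matrix.one_mul]
      obtain ⟨hA, hB⟩ := shape A l B hAB
      have hlw : l ∈ w := by rw [hAB]; simp
      rcases three l.1 with hi | hi | hi
      · rw [hi, hA.2.1, zero_mul, zero_mul]
      · rw [hi, hA.2.2.1, zero_mul, zero_mul]
      · rw [hi, hA.2.2.2.2.2, one_mul]
        rcases three l.2.1 with hj | hj | hj
        · rw [far20 l hlw hi hj]; simp
        · rw [hj, hB.2.2.2.2.1, mul_one]; exact hc_of_tame l (row2mem l hlw hi).1
        · exact absurd (hi.trans hj.symm) (hw l hlw)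
    have K := k2_kill v w 1 1 2 1 hnn
    have hsum : (1 * (Matrix.map ((w.map (fun l => (Matrix.transvection (Prod.fst l) (Prod.fst (Prod.snd l)) (MvPolynomial.C (Prod.fst (Prod.snd (Prod.snd l))) * Option.elim (Prod.snd (Prod.snd (Prod.snd l))) 1 MvPolynomial.X) : Matrix (Fin 3) (Fin 3) (MvPolynomial σ ℝ)))).prod) (fun p => MvPolynomial.constantCoeff (MvPolynomial.pderiv v p)) : Matrix (Fin 3) (Fin 3) ℝ) * 1 : Matrix (Fin 3) (Fin 3) ℝ) 2 1 = 0 := by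
      rw [hF, k2Dm_far v F hdeg2]; simp
    have := K.2 hsum A l B hAB hv
    obtain ⟨hA, hB⟩ := shape A l B hAB
    rw [hi, hj, Matrix.mul_one, Matrix.one_mul, hA.2.2.2.2.2, hB.2.2.2.2.1, one_mul, mul_one] at this
    exact this
  -- every letter with nonzero coefficient is of type x₁ or x₂
  have hx : ∀ l ∈ w, l.2.2.1 ≠ 0 → (l.1 = 0 ∧ l.2.1 = 1) ∨ (l.1 = 1 ∧ l.2.1 = 2) := by
    intro l hl hc
    rcases three l.1 with hi | hi | hi <;> rcases three l.2.1 with hj | hj | hj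
    · exact absurd (hi.trans hj.symm) (hw l hl)
    · exact Or.inl ⟨hi, hj⟩
    · -- (0,2): far letter of a stretch, coefficient 0
      exfalso
      rcases k2_mem_word p0 q p2 L1 L2 l hl with rfl | rfl | hl'
      · exact absurd (hL1.1.symm.trans hi) (by decide)
      · exact absurd (hL2.2.symm.trans hj) (by decide)
      · rcases ht l hl' with ⟨-, hadj⟩ | h0
        · rw [hi, hj] at hadj; simp at hadj
        · exact hc h0
    · exfalso
      obtain ⟨htl, hl'⟩ := col0mem l hl hj
      rcases ho : l.2.2.2 with _ | v
      · exact hc ((conf l hl' ho).1 hi hj)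
      · exact hc (killed1 l hl hi hj v ho)
    · exact absurd (hi.trans hj.symm) (hw l hl)
    · exact Or.inr ⟨hi, hj⟩
    · exact absurd (far20 l hl hi hj) hc
    · exfalso
      obtain ⟨htl, hl'⟩ := row2mem l hl hi
      rcases ho : l.2.2.2 with _ | v
      · exact hc ((conf l hl' ho).2 hi hj)
      · exact hc (killed2 l hl hi hj v ho)
    · exact absurd (hi.trans hj.symm) (hw l hl)
  have htd := k2_close_upper F w hx hF
  obtain ⟨m, hm⟩ := MvPolynomial.ne_zero_iff.1 hF0
  have hms : m ∈ F.support := MvPolynomial.mem_support_iff.2 hm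
  have := MvPolynomial.coeff_eq_zero_of_totalDegree_lt
    (show F.totalDegree < Finsupp.degree m from by have := hdeg m hms; omega)
  exact hm this

end Summit.ValiantsHypothesis.ValiantsHypothesis.Cruxes.WordLengthQP.PositiveMonoidExits

end
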